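import Summits.MatrixMultiplication.MatrixMultiplication.Theorems.AbelianSTPPCensusTAStatRows
import Summits.MatrixMultiplication.MatrixMultiplication.Theorems.AbelianSTPPCensusTALin1200Sound
import Summits.MatrixMultiplication.MatrixMultiplication.Theorems.AbelianSTPPCensusTAKnap575Sound

/-!
# T_A certificate past 1700 (static t*-indexed linear checker): soundness lemmas (part 2a, the arithmetic toolbox)

Cell mm-stpp (rung F-M1), threshold T_A = `τ = 2.371`; checker and design in `AbelianSTPPCensusTAStatDefs.lean`, data facts and certificate
unpacking in `AbelianSTPPCensusTAStatRows.lean`.  Proofs only: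
* `budget_form'`, `grynkiewicz_budget'_A/B/C`: the Grynkiewicz budget of a member `m` at ANY parameter `t′` with
  `(smallest size of m) < t′ ≤ t_m = (smallest)·(middle)`, `t′ ≥ 3`: `t′·Σ_i p_i + 1 ≤ Σ_i V_i + t′·M + 2t′²` (the tree rule `U11GFormB` at `t′`:
  the fibre budget `L(t′) ≥ t_m ≥ t′` and the pair sums `≥ t′` are witnessed by `m` alone; cf. `TALin1200.budget_form`, the case `t′ = t_m`);
* `exists_sorted`: the sorted form of a candidate shape (as `TALin1200.exists_sorted`, at this universe), `tm_of_smallest`;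
* `affine_between`, `quad_between`: an affine (resp. the E3 quadratic) comparison that holds at two orders holds at every order between them;
The main estimate `sum_gain_le` / `not_beats_of_cert` is in `AbelianSTPPCensusTAStatSound.lean`.
WHAT THIS IS NOT: no statement about STPP families beyond the consequences vM / U11-G / E3 of their shape data; no bound on `ω`.
-/

set_option linter.dupNamespace false
set_option autoImplicit false

namespace Summit.MatrixMultiplication.MatrixMultiplication.Theorems.TAStat

open TECert (tableOK vol us tableOK_iff tableOK_mono)
open ShapeCert (gainOf2371h D)
open TAStatData (E VL TB nl nb)

/-! ## The Grynkiewicz budget of a member at a parameter `t′ ≤ t_m` -/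

section budget

variable {N M : ℕ}

/-- **Grynkiewicz budget, one letter form, free parameter.**  If form B of U11-G holds for the letters `(x,y,z)` at order `M` and `P_CA ≤ M`, then
for every member `l` and every `t` with `3 ≤ t`, `y_l < t` and `t ≤ y_l · min(x_l, z_l)`:
`t·(P_AB + P_BC + P_CA) + 1 ≤ Σ_i x_i y_i z_i + t·M + 2t²` (the fibre budget `L(t) ≥ y_l·min(x_l,z_l) ≥ t` and the pair sums `≥ t` are witnessed by
`l` alone). [original] -/
theorem budget_form' {x y z : Fin N → ℕ} (hF : U11GFormB M x y z) (hP : pCA x y z ≤ M) (l : Fin N) {t : ℕ}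
    (hyt : y l < t) (ht : t ≤ y l * min (x l) (z l)) (ht3 : 3 ≤ t) :
    t * (pAB x y z + pBC x y z + pCA x y z) + 1 ≤ (∑ i, x i * y i * z i) + t * M + 2 * t ^ 2 := by
  have hpab : t ≤ pAB x y z := by
    calc t ≤ y l * min (x l) (z l) := ht
      _ ≤ y l * x l := Nat.mul_le_mul_left _ (min_le_left _ _)
      _ = x l * y l := by ring
      _ ≤ pAB x y z := Finset.single_le_sum (f := fun i => x i * y i) (fun i _ => Nat.zero_le _) (Finset.mem_univ l)
  have hpbc : t ≤ pBC x y z := by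
    calc t ≤ y l * min (x l) (z l) := ht
      _ ≤ y l * z l := Nat.mul_le_mul_left _ (min_le_right _ _)
      _ ≤ pBC x y z := Finset.single_le_sum (f := fun i => y i * z i) (fun i _ => Nat.zero_le _) (Finset.mem_univ l)
  have hlb : t ≤ lB x y z t := by
    calc t ≤ y l * min (x l) (z l) := ht
      _ = (if y l < t then y l * min (x l) (z l) else 0) := by rw [if_pos hyt]
      _ ≤ lB x y z t := Finset.single_le_sum (f := fun i => if y i < t then y i * min (x i) (z i) else 0)
          (fun i _ => Nat.zero_le _) (Finset.mem_univ l)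
  have key := (hF t (by omega) hpab hpbc hlb).2 ht3
  have hub := TALin1200.ubB_le (M := M) x y z t
  have hsub : t * (M - pCA x y z) + t * pCA x y z = t * M := by rw [← Nat.mul_add, Nat.sub_add_cancel hP]
  have e1 : t * (pAB x y z + pBC x y z + pCA x y z) = t * pAB x y z + t * pBC x y z + t * pCA x y z := by ring
  have e2 : t * (pAB x y z + pBC x y z) = t * pAB x y z + t * pBC x y z := by ring
  rw [e1]; rw [e2] at key
  omega

/-- letter `b` smallest -/
theorem grynkiewicz_budget'_B {a b c : Fin N → ℕ} (hS : SieveAdmissible M a b c) (hG : U11G M a b c) (l : Fin N) {t : ℕ}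
    (hyt : b l < t) (ht : t ≤ b l * min (a l) (c l)) (ht3 : 3 ≤ t) :
    t * (∑ i, (a i * b i + b i * c i + c i * a i)) + 1 ≤ (∑ i, a i * b i * c i) + t * M + 2 * t ^ 2 := by
  obtain ⟨-, -, ⟨-, -, uca⟩, -⟩ := hS
  have h := budget_form' hG.1 (by simpa [pCA] using uca) l hyt ht ht3
  rw [TALin1200.sum_us_eq]; exact h

/-- letter `a` smallest (form A = letters `(c,a,b)`) -/
theorem grynkiewicz_budget'_A {a b c : Fin N → ℕ} (hS : SieveAdmissible M a b c) (hG : U11G M a b c) (l : Fin N) {t : ℕ}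
    (hyt : a l < t) (ht : t ≤ a l * min (c l) (b l)) (ht3 : 3 ≤ t) :
    t * (∑ i, (a i * b i + b i * c i + c i * a i)) + 1 ≤ (∑ i, a i * b i * c i) + t * M + 2 * t ^ 2 := by
  obtain ⟨-, -, ⟨-, ubc, -⟩, -⟩ := hS
  have h := budget_form' hG.2.1 (by simpa [pCA] using ubc) l hyt ht ht3
  have e1 : pAB c a b + pBC c a b + pCA c a b = pAB a b c + pBC a b c + pCA a b c := by
    simp only [pAB, pBC, pCA]; ring
  have e2 : ∑ i, c i * a i * b i = ∑ i, a i * b i * c i := Finset.sum_congr rfl fun i _ => by ring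
  rw [e1, e2] at h
  rw [TALin1200.sum_us_eq]; exact h

/-- letter `c` smallest (form C = letters `(b,c,a)`) -/
theorem grynkiewicz_budget'_C {a b c : Fin N → ℕ} (hS : SieveAdmissible M a b c) (hG : U11G M a b c) (l : Fin N) {t : ℕ}
    (hyt : c l < t) (ht : t ≤ c l * min (b l) (a l)) (ht3 : 3 ≤ t) :
    t * (∑ i, (a i * b i + b i * c i + c i * a i)) + 1 ≤ (∑ i, a i * b i * c i) + t * M + 2 * t ^ 2 := by
  obtain ⟨-, -, ⟨uab, -, -⟩, -⟩ := hS
  have h := budget_form' hG.2.2 (by simpa [pCA] using uab) l hyt ht ht3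
  have e1 : pAB b c a + pBC b c a + pCA b c a = pAB a b c + pBC a b c + pCA a b c := by
    simp only [pAB, pBC, pCA]; ring
  have e2 : ∑ i, b i * c i * a i = ∑ i, a i * b i * c i := Finset.sum_congr rfl fun i _ => by ring
  rw [e1, e2] at h
  rw [TALin1200.sum_us_eq]; exact h

end budget

/-! ## Sorted forms -/

/-- Every shape with sizes `≥ 1` passing the table at `Mtop` has a sorted candidate form `y` with the same volume, pair-product sum and size sum,
whose first two entries are the smallest size and the smaller of the other two, in one of the three letter positions. [bookkeeping] -/
theorem exists_sorted (a b c : ℕ) (ha : 1 ≤ a) (hb : 1 ≤ b) (hc : 1 ≤ c) (ht : tableOK Mtop a b c = true) :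
    ∃ y : ℕ × ℕ × ℕ, SCand y ∧ vol y = a * b * c ∧ us y = a * b + b * c + c * a ∧ y.1 + y.2.1 + y.2.2 = a + b + c ∧
      ((y.1 = a ∧ y.2.1 = min c b ∧ a ≤ c ∧ a ≤ b) ∨ (y.1 = b ∧ y.2.1 = min a c ∧ b ≤ a ∧ b ≤ c) ∨
        (y.1 = c ∧ y.2.1 = min b a ∧ c ≤ b ∧ c ≤ a)) := by
  rcases le_total a b with hab | hab <;> rcases le_total b c with hbc | hbc <;> rcases le_total a c with hac | hac
  · exact ⟨(a, b, c), ⟨ha, hab, hbc, ht⟩, rfl, rfl, rfl, Or.inl ⟨rfl, by show b = min c b; rw [min_eq_right hbc], hac, hab⟩⟩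
  · exact ⟨(a, b, c), ⟨ha, hab, hbc, ht⟩, rfl, rfl, rfl, Or.inl ⟨rfl, by show b = min c b; rw [min_eq_right hbc], le_trans hab hbc, hab⟩⟩
  · exact ⟨(a, c, b), ⟨ha, hac, hbc, TALin1200.tableOK_swap23 ht⟩, by show a * c * b = a * b * c; ring,
      by show a * c + c * b + b * a = a * b + b * c + c * a; ring, by show a + c + b = a + b + c; ring,
      Or.inl ⟨rfl, by show c = min c b; rw [min_eq_left hbc], hac, hab⟩⟩
  · exact ⟨(c, a, b), ⟨hc, hac, hab, TALin1200.tableOK_swap23 (TALin1200.tableOK_swap13 ht)⟩, by show c * a * b = a * b * c; ring,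
      by show c * a + a * b + b * c = a * b + b * c + c * a; ring, by show c + a + b = a + b + c; ring,
      Or.inr (Or.inr ⟨rfl, by show a = min b a; rw [min_eq_right hab], le_trans hac hab, hac⟩)⟩
  · exact ⟨(b, a, c), ⟨hb, hab, hac, TALin1200.tableOK_swap12 ht⟩, by show b * a * c = a * b * c; ring,
      by show b * a + a * c + c * b = a * b + b * c + c * a; ring, by show b + a + c = a + b + c; ring,
      Or.inr (Or.inl ⟨rfl, by show a = min a c; rw [min_eq_left hac], hab, hbc⟩)⟩
  · exact ⟨(b, c, a), ⟨hb, hbc, hac, TALin1200.tableOK_swap23 (TALin1200.tableOK_swap12 ht)⟩, by show b * c * a = a * b * c; ring,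
      by show b * c + c * a + a * b = a * b + b * c + c * a; ring, by show b + c + a = a + b + c; ring,
      Or.inr (Or.inl ⟨rfl, by show c = min a c; rw [min_eq_right hac], hab, hbc⟩)⟩
  · exact ⟨(c, b, a), ⟨hc, hbc, hab, TALin1200.tableOK_swap13 ht⟩, by show c * b * a = a * b * c; ring,
      by show c * b + b * a + a * c = a * b + b * c + c * a; ring, by show c + b + a = a + b + c; ring,
      Or.inr (Or.inr ⟨rfl, by show b = min b a; rw [min_eq_left hab], hbc, le_trans hbc hab⟩)⟩
  · exact ⟨(c, b, a), ⟨hc, hbc, hab, TALin1200.tableOK_swap13 ht⟩, by show c * b * a = a * b * c; ring,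
      by show c * b + b * a + a * c = a * b + b * c + c * a; ring, by show c + b + a = a + b + c; ring,
      Or.inr (Or.inr ⟨rfl, by show b = min b a; rw [min_eq_left hab], hbc, hac⟩)⟩

/-- the least of three numbers, identified -/
theorem min3_eq {x y z v : ℕ} (h1 : v ≤ x) (h2 : v ≤ y) (h3 : v ≤ z) (h4 : v = x ∨ v = y ∨ v = z) :
    min (min x y) z = v := by
  refine le_antisymm ?_ (le_min (le_min h1 h2) h3)
  rcases h4 with rfl | rfl | rfl
  · exact le_trans (min_le_left _ _) (min_le_left _ _)
  · exact le_trans (min_le_left _ _) (min_le_right _ _)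
  · exact min_le_right _ _

/-- `tm` when `a` is the smallest size -/
theorem tm_a {a b c : ℕ} (hab : a ≤ b) (hac : a ≤ c) : tm (a, b, c) = a * min c b := by
  simp only [tm]
  rcases le_total c b with hcb | hbc
  · rw [min_eq_left hcb]
    exact min3_eq (Nat.mul_le_mul_left a hcb) (Nat.mul_le_mul_right c hab) (Nat.mul_comm a c).le
      (Or.inr (Or.inr (Nat.mul_comm a c)))
  · rw [min_eq_right hbc]
    exact min3_eq le_rfl ((Nat.mul_le_mul_right b hac).trans_eq (Nat.mul_comm c b))
      ((Nat.mul_le_mul_left a hbc).trans_eq (Nat.mul_comm a c)) (Or.inl rfl)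

/-- `tm` when `b` is the smallest size -/
theorem tm_b {a b c : ℕ} (hba : b ≤ a) (hbc : b ≤ c) : tm (a, b, c) = b * min a c := by
  simp only [tm]
  rcases le_total a c with hac | hca
  · rw [min_eq_left hac]
    exact min3_eq (Nat.mul_comm b a).le (Nat.mul_le_mul_left b hac) (Nat.mul_le_mul_right a hbc)
      (Or.inl (Nat.mul_comm b a))
  · rw [min_eq_right hca]
    exact min3_eq ((Nat.mul_le_mul_left b hca).trans_eq (Nat.mul_comm b a)) le_rfl
      ((Nat.mul_le_mul_right c hba).trans_eq (Nat.mul_comm a c)) (Or.inr (Or.inl rfl))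

/-- `tm` when `c` is the smallest size -/
theorem tm_c {a b c : ℕ} (hcb : c ≤ b) (hca : c ≤ a) : tm (a, b, c) = c * min b a := by
  simp only [tm]
  rcases le_total b a with hba | hab
  · rw [min_eq_left hba]
    exact min3_eq (Nat.mul_le_mul_right b hca) (Nat.mul_comm c b).le (Nat.mul_le_mul_left c hba)
      (Or.inr (Or.inl (Nat.mul_comm c b)))
  · rw [min_eq_right hab]
    exact min3_eq ((Nat.mul_comm c a).le.trans (Nat.mul_le_mul_left a hcb))
      ((Nat.mul_le_mul_left c hab).trans_eq (Nat.mul_comm c b)) le_rfl (Or.inr (Or.inr rfl))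

/-- the value of `tm` read off the sorted form: in each letter case `tm (a,b,c) = y.1 · y.2.1` -/
theorem tm_eq_of_cases {a b c : ℕ} {y : ℕ × ℕ × ℕ}
    (h : (y.1 = a ∧ y.2.1 = min c b ∧ a ≤ c ∧ a ≤ b) ∨ (y.1 = b ∧ y.2.1 = min a c ∧ b ≤ a ∧ b ≤ c) ∨
      (y.1 = c ∧ y.2.1 = min b a ∧ c ≤ b ∧ c ≤ a)) : tm (a, b, c) = y.1 * y.2.1 := by
  rcases h with ⟨h1, h2, hac, hab⟩ | ⟨h1, h2, hba, hbc⟩ | ⟨h1, h2, hcb, hca⟩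
  · rw [h1, h2]; exact tm_a hab hac
  · rw [h1, h2]; exact tm_b hba hbc
  · rw [h1, h2]; exact tm_c hcb hca

/-! ## Interval lemmas -/

/-- An affine comparison `α·M + β ≤ γ·M + δ` that holds at `M₁` and at `M₂` holds at every `M₁ ≤ M ≤ M₂`. [bookkeeping] -/
theorem affine_between {α β γ δ M₁ M M₂ : ℕ} (h1 : M₁ ≤ M) (h2 : M ≤ M₂)
    (hA : α * M₁ + β ≤ γ * M₁ + δ) (hB : α * M₂ + β ≤ γ * M₂ + δ) : α * M + β ≤ γ * M + δ := by
  rcases le_total α γ with hle | hle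
  · obtain ⟨k, rfl⟩ := Nat.exists_eq_add_of_le h1
    have hk : α * k ≤ γ * k := Nat.mul_le_mul_right _ hle
    have e1 : α * (M₁ + k) = α * M₁ + α * k := by ring
    have e2 : γ * (M₁ + k) = γ * M₁ + γ * k := by ring
    rw [e1, e2]; omega
  · obtain ⟨k, rfl⟩ := Nat.exists_eq_add_of_le h2
    have hk : γ * k ≤ α * k := Nat.mul_le_mul_right _ hle
    have e1 : α * (M + k) = α * M + α * k := by ring
    have e2 : γ * (M + k) = γ * M + γ * k := by ring
    rw [e1, e2] at hB; omega

/-- The E3 comparison `g·pP·M + 3M²·gP + V²·gP ≤ 10⁶·M²·pP + 4V·M·gP` that holds at `m ≥ 1` and at `m₂` holds at every `m ≤ M ≤ m₂`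
(an increasing function of `M` if `10⁶·pP ≥ 3·gP`, else a concave quadratic). [bookkeeping] -/
theorem quad_between {g V m M m₂ : ℕ} {e : Entry} (hm : 1 ≤ m) (h1 : m ≤ M) (h2 : M ≤ m₂)
    (hA : p3I g V m e = true) (hB : p3I g V m₂ e = true) : p3I g V M e = true := by
  simp only [p3I, Nat.ble_eq] at hA hB ⊢
  -- pass to ℤ: Q(X) = a X² + c X − k with a = D pP − 3 gP, c = 4 V gP − g pP, k = V² gP
  have key : ∀ X : ℕ, (g * e.2.1 * X + 3 * X * X * e.1 + V * V * e.1 ≤ D * X * X * e.2.1 + 4 * V * X * e.1) ↔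
      (0 : ℤ) ≤ ((D : ℤ) * e.2.1 - 3 * e.1) * X * X + (4 * V * e.1 - g * e.2.1) * X - V * V * e.1 := by
    intro X; constructor
    · intro h; have h' : ((g * e.2.1 * X + 3 * X * X * e.1 + V * V * e.1 : ℕ) : ℤ) ≤ ((D * X * X * e.2.1 + 4 * V * X * e.1 : ℕ) : ℤ) := by
        exact_mod_cast h
      push_cast at h'; nlinarith
    · intro h
      have h' : ((g * e.2.1 * X + 3 * X * X * e.1 + V * V * e.1 : ℕ) : ℤ) ≤ ((D * X * X * e.2.1 + 4 * V * X * e.1 : ℕ) : ℤ) := by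
        push_cast; nlinarith
      exact_mod_cast h'
  rw [key] at hA hB ⊢
  set a : ℤ := (D : ℤ) * e.2.1 - 3 * e.1 with ha
  set c : ℤ := 4 * (V : ℤ) * e.1 - g * e.2.1 with hc
  set k : ℤ := (V : ℤ) * V * e.1 with hk
  have hk0 : 0 ≤ k := by rw [hk]; positivity
  have hm' : (1 : ℤ) ≤ m := by exact_mod_cast hm
  have h1' : (m : ℤ) ≤ M := by exact_mod_cast h1
  have h2' : (M : ℤ) ≤ m₂ := by exact_mod_cast h2
  rcases le_or_gt 0 a with ha0 | ha0
  · -- increasing case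
    have e1 : a * m * m + c * m - k = m * (a * m + c) - k := by ring
    have h3 : 0 ≤ a * m + c := by
      by_contra hlt
      push Not at hlt
      have := mul_neg_of_pos_of_neg (by linarith : (0 : ℤ) < m) hlt
      linarith
    have h5 : 0 ≤ a * (M : ℤ) := mul_nonneg ha0 (by positivity)
    have h6 : 0 ≤ a * ((M : ℤ) + m) + c := by nlinarith
    have h4 : 0 ≤ ((M : ℤ) - m) * (a * (M + m) + c) := mul_nonneg (by linarith) h6
    have e2 : a * M * M + c * M - k = (a * m * m + c * m - k) + (M - m) * (a * (M + m) + c) := by ring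
    linarith
  · -- concave case: if Q(M) < 0 then Q(m₂) < 0
    by_contra hneg
    push Not at hneg
    have d1 : (a * M * M + c * M - k) - (a * m * m + c * m - k) = (M - m) * (a * (M + m) + c) := by ring
    have hprod : ((M : ℤ) - m) * (a * (M + m) + c) < 0 := by linarith
    have hfac : a * ((M : ℤ) + m) + c < 0 := by
      by_contra hge
      push Not at hge
      have := mul_nonneg (by linarith : (0 : ℤ) ≤ M - m) hge
      linarith
    have hstep : a * ((m₂ : ℤ) + M) + c ≤ a * (M + m) + c := by
      have : a * ((m₂ : ℤ) - m) ≤ 0 := mul_nonpos_of_nonpos_of_nonneg ha0.le (by linarith)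
      linarith
    have hfac2 : a * ((m₂ : ℤ) + M) + c < 0 := lt_of_le_of_lt hstep hfac
    have d2 : (a * m₂ * m₂ + c * m₂ - k) - (a * M * M + c * M - k) = (m₂ - M) * (a * (m₂ + M) + c) := by ring
    have : ((m₂ : ℤ) - M) * (a * (m₂ + M) + c) ≤ 0 := mul_nonpos_of_nonneg_of_nonpos (by linarith) hfac2.le
    linarith

/-- U11-G bound monotonicity: with slope `t·gW ≤ 10⁶·wW`, `vpI` at `M₁` gives `vpI` at every `M ≥ M₁`. [bookkeeping] -/
theorem vp_mono {g p V t M₁ M : ℕ} {e : Entry} (hslope : t * e.2.2.1 ≤ D * e.2.2.2) (h1 : M₁ ≤ M)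
    (hA : vpI g p V t M₁ e = true) : vpI g p V t M e = true := by
  simp only [vpI, Nat.ble_eq] at hA ⊢
  obtain ⟨k, rfl⟩ := Nat.exists_eq_add_of_le h1
  have hk : t * e.2.2.1 * k ≤ D * e.2.2.2 * k := Nat.mul_le_mul_right _ hslope
  have e1 : t * e.2.2.1 * (M₁ + k) = t * e.2.2.1 * M₁ + t * e.2.2.1 * k := by ring
  have e2 : D * e.2.2.2 * (M₁ + k) = D * e.2.2.2 * M₁ + D * e.2.2.2 * k := by ring
  rw [e1, e2]; omega

/-- U11-cap comparison between two orders. [bookkeeping] -/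
theorem p1_between {g d m₁ M m₂ : ℕ} {e : Entry} (h1 : m₁ ≤ M) (h2 : M ≤ m₂)
    (hA : p1I g d m₁ e = true) (hB : p1I g d m₂ e = true) : p1I g d M e = true := by
  simp only [p1I, Nat.ble_eq] at hA hB ⊢
  rcases le_total (3 * e.1) (2 * D * e.2.1) with hle | hle
  · obtain ⟨k, rfl⟩ := Nat.exists_eq_add_of_le h1
    have hk : 3 * e.1 * k ≤ 2 * D * e.2.1 * k := Nat.mul_le_mul_right k hle
    have e1 : 3 * (m₁ + k) * e.1 = 3 * m₁ * e.1 + 3 * e.1 * k := by ring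
    have e2 : 2 * D * (m₁ + k) * e.2.1 = 2 * D * m₁ * e.2.1 + 2 * D * e.2.1 * k := by ring
    rw [e1, e2]; omega
  · obtain ⟨k, rfl⟩ := Nat.exists_eq_add_of_le h2
    have hk : 2 * D * e.2.1 * k ≤ 3 * e.1 * k := Nat.mul_le_mul_right k hle
    have e1 : 3 * (M + k) * e.1 = 3 * M * e.1 + 3 * e.1 * k := by ring
    have e2 : 2 * D * (M + k) * e.2.1 = 2 * D * M * e.2.1 + 2 * D * e.2.1 * k := by ring
    rw [e1, e2] at hB; omega

/-- U14-cap comparison between two orders. [bookkeeping] -/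
theorem p2_between {g V m₁ M m₂ : ℕ} {e : Entry} (h1 : m₁ ≤ M) (h2 : M ≤ m₂)
    (hA : p2I g V m₁ e = true) (hB : p2I g V m₂ e = true) : p2I g V M e = true := by
  simp only [p2I, Nat.ble_eq] at hA hB ⊢
  rcases le_total (3 * e.1) (D * e.2.1) with hle | hle
  · obtain ⟨k, rfl⟩ := Nat.exists_eq_add_of_le h1
    have hk : 3 * e.1 * k ≤ D * e.2.1 * k := Nat.mul_le_mul_right k hle
    have e1 : 3 * (m₁ + k) * e.1 = 3 * m₁ * e.1 + 3 * e.1 * k := by ring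
    have e2 : D * (m₁ + k) * e.2.1 = D * m₁ * e.2.1 + D * e.2.1 * k := by ring
    rw [e1, e2]; omega
  · obtain ⟨k, rfl⟩ := Nat.exists_eq_add_of_le h2
    have hk : D * e.2.1 * k ≤ 3 * e.1 * k := Nat.mul_le_mul_right k hle
    have e1 : 3 * (M + k) * e.1 = 3 * M * e.1 + 3 * e.1 * k := by ring
    have e2 : D * (M + k) * e.2.1 = D * M * e.2.1 + D * e.2.1 * k := by ring
    rw [e1, e2] at hB; omega

/-- what a verified threshold certifies -/
theorem vpThresh_le {g p V t L H : ℕ} {e : Entry} (h : vpThresh g p V t L H e ≤ H) :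
    3 ≤ t ∧ V < t * p ∧ t * e.2.2.1 ≤ D * e.2.2.2 ∧ vpI g p V t (vpThresh g p V t L H e) e = true ∧
      t * p - V ≤ t * vpThresh g p V t L H e := by
  unfold vpThresh at h ⊢
  simp only at h ⊢
  split_ifs at h ⊢ with hc
  · exact ⟨hc.1, hc.2.1, hc.2.2.1, hc.2.2.2.2.1, hc.2.2.2.2.2⟩
  · omega

/-- E3 cap arithmetic: with `V ≤ M`, `((V²/M + 3M) − 4V)·M + 4V·M ≤ V² + 3M²`. [bookkeeping] -/
theorem capE_mul_le {V M : ℕ} (hVM : V ≤ M) : ((V * V / M + 3 * M) - 4 * V) * M + 4 * V * M ≤ V * V + 3 * M * M := by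
  have hq : V * V / M * M ≤ V * V := Nat.div_mul_le_self _ _
  rcases Nat.lt_or_ge (V * V / M + 3 * M) (4 * V) with hlt | hle
  · have h0 : (V * V / M + 3 * M) - 4 * V = 0 := Nat.sub_eq_zero_of_le hlt.le
    rw [h0, zero_mul, zero_add]
    have hz : (0 : ℤ) ≤ ((M : ℤ) - V) * (3 * M - V) := mul_nonneg (by omega) (by omega)
    have e : ((M : ℤ) - V) * (3 * M - V) = 3 * M * M - 4 * V * M + V * V := by ring
    have : (4 * V * M : ℤ) ≤ V * V + 3 * M * M := by linarith
    exact_mod_cast this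
  · have : ((V * V / M + 3 * M) - 4 * V) * M + 4 * V * M = (V * V / M + 3 * M) * M := by
      rw [← Nat.add_mul, Nat.sub_add_cancel hle]
    rw [this, Nat.add_mul]
    have e3 : 3 * M * M = 3 * M * M := rfl
    calc V * V / M * M + 3 * M * M ≤ V * V + 3 * M * M := Nat.add_le_add_right hq _

end Summit.MatrixMultiplication.MatrixMultiplication.Theorems.TAStat
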